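import Literature.Computability.Complexity.UmansRecon
import Literature.Computability.Complexity.UmansParams
import Literature.Computability.Complexity.UmansFPGenFP
import Literature.Computability.Complexity.TVHardness
import HarnessLib

/-!
# Umans' generator (Murray–Williams Thm. 2.3) and the discharge of Lemma 4.1 (a.e.)

Literature / circuit complexity — derandomization. The heart of C. Umans, *Pseudo-random
generators for all hardnesses*, JCSS 67 (2003), Thm. 6 / Thm. 14, assembled (part `Core`): at the
parameters of `UmansParams.lean` (regime `m ≥ 2²⁰`, `log₂ n ≤ m/4`), a `B₂`-circuit `C` of size
`≤ m` with advantage `> 1/m` against the parsed-seed binary generator of the table `xs = padTable Y`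
yields — through the dense next-element predictor, the good reference curves of Thm. 14 and the
polynomial-time reconstruction machine (all in `UmansRecon.lean`) — an advice
`adv` on which the machine reads `x_i` from `i`, whence `CC(Y) ≤ Q_H(|adv| + ℓ)`; and `|adv|` is
polynomially bounded in `m`.

Then the final assembly in the interface of C. D. Murray, R. R. Williams, STOC 2018, Thm. 2.3
(`UmansGenerator`, `MurrayWilliams2018SimulationProofs.lean`): the string function `F = genTop 16`
(`UmansFPGenFP.lean`, polynomial time), the seed constant `g = 61 deg Q_H + Q_H(1) + 2⁶¹`, and the
pseudorandomness: if the seed is at least as long as the target the output IS uniform; otherwise a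
distinguisher of size `s` and advantage `> 1/s` would give (`core_advice`, `length_advE_le`,
`stringCC_le_of_advice`) `CC(Y) ≤ Q_H((s+3)⁶⁰ + ℓ) < sᵍ`, contradicting `sᵍ ≤ CC(Y)`.
Consequently the tree's closer `MurrayWilliams2018_lemma_4_1_ae_of_umansGenerator` discharges the
named fact `MurrayWilliams2018_lemma_4_1_ae`.

* `density` (the `μ ≥ q/(2m²)` bound), `emb_bound` (node embeddings), `zL_eq_zOf`;
* **`core_advice`** — the advice and its correctness; **`length_advE_le`** — its length bound;
* **`core_bound`** — `CC(Y) ≤ Q_H((m+3)^{60} + ℓ)`;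
* `umansGenerator : UmansGenerator` — **Umans' Thm. 6 / Murray–Williams Thm. 2.3**;
* `MurrayWilliams2018_lemma_4_1_ae_of_umans` — Lemma 4.1 (a.e.) unconditionally (the `_holds`
  discharge is appended to `MurrayWilliams2018EasyWitnessProofs.lean`).

Everything is proved; no named fact.

## References

* C. Umans, *Pseudo-random generators for all hardnesses*, JCSS 67 (2003), Thm. 6, Thm. 14, §5
  [Umans2003].
* C. D. Murray, R. R. Williams, *Circuit lower bounds for nondeterministic quasi-polytime …*,
  STOC 2018, Thm. 2.3, Thm. 3.1, Lemma 4.1 [MurrayWilliams2018].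
-/

noncomputable section

namespace Literature.Computability.Complexity

open Polynomial Finset Literature.InformationTheory.Coding
open Literature.InformationTheory.Coding.GF2X CodeFP

namespace UmansFP

open Prm

namespace PrmOK

section Core

variable {cap a M d c0 : ℕ} [hirr : Fact (Irreducible (pOf M (pcOf cap a M d)))]
variable (V : PrmOK cap a M d c0)
include V

/-- **The density of good seeds**: from `|L| ≤ m²(#good + 1)` and `2m² ≤ q`, the density
`μ = q · #good / |L|` is at least `q/(2m²)`. [cite: Umans2003, Thm. 14 (proof, "`ρ = ε/2m`")] -/
theorem density {m good : ℕ} (hm : 1 ≤ m) (hq : 2 * m ^ 2 ≤ 2 ^ (M + 1)) (hgood : Fintype.card (LF cap a M d) ≤ m ^ 2 * (good + 1)) :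
    ((2 ^ (M + 1) : ℕ) : ℝ) / (2 * m ^ 2) ≤ ((2 ^ (M + 1) : ℕ) : ℝ) * (good : ℝ) / Fintype.card (LF cap a M d) := by
  set q : ℝ := ((2 ^ (M + 1) : ℕ) : ℝ) with hqd
  set Lc : ℝ := (Fintype.card (LF cap a M d) : ℝ) with hL
  have hLq : ((2 ^ (M + 1) : ℕ) : ℝ) ≤ Lc := by
    rw [hL, card_LF V.hlen]; exact_mod_cast Nat.le_self_pow (by have := V.hd; omega) _
  have hq2 : (2 * m ^ 2 : ℝ) ≤ q := by rw [hqd]; exact_mod_cast hq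
  have hL0 : 0 < Lc := lt_of_lt_of_le (by positivity) hLq
  have hm2 : (0 : ℝ) < 2 * m ^ 2 := by positivity
  have hg : Lc ≤ m ^ 2 * (good + 1) := by rw [hL]; exact_mod_cast hgood
  rw [div_le_div_iff₀ hm2 hL0]
  -- `q Lc ≤ q good · 2m²` ⟸ `Lc ≤ 2 m² good` ⟸ `Lc ≤ m² good + m²` and `m² ≤ Lc/2`
  have hq0 : 0 ≤ q := by rw [hqd]; positivity
  nlinarith [mul_le_mul_of_nonneg_left hg hq0]

omit V hirr in
/-- **The node embeddings are many**: `|Idx ↪ K| ≥ (q - r)^r` (`r = (d+1) r' ≤ q`). [folklore] -/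
theorem emb_bound {r' : ℕ} (hr : (d + 1) * r' ≤ 2 ^ (M + 1)) :
    (((2 ^ (M + 1) : ℕ) : ℝ) - (d + 1) * r') ^ ((d + 1) * r') ≤ Fintype.card (UmansRec.Idx d r' ↪ GF2 M) ∧
      (0 : ℝ) < Fintype.card (UmansRec.Idx d r' ↪ GF2 M) := by
  classical
  have hcard : Fintype.card (UmansRec.Idx d r' ↪ GF2 M) = (2 ^ (M + 1)).descFactorial ((d + 1) * r') := by
    rw [Fintype.card_embedding_eq, card_GF2]
    simp only [UmansRec.Idx, Fintype.card_prod, Fintype.card_fin]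
  have hle := Nat.pow_sub_le_descFactorial (2 ^ (M + 1)) ((d + 1) * r')
  rw [hcard]
  constructor
  · calc (((2 ^ (M + 1) : ℕ) : ℝ) - (d + 1) * r') ^ ((d + 1) * r') ≤ (((2 ^ (M + 1) + 1 - (d + 1) * r' : ℕ)) : ℝ) ^ ((d + 1) * r') := by
          apply pow_le_pow_left₀ (sub_nonneg.2 (by exact_mod_cast hr))
          rw [Nat.cast_sub (by omega)]; push_cast; linarith
      _ ≤ _ := by exact_mod_cast hle
  · exact_mod_cast Nat.descFactorial_pos.2 hr

end Core

end PrmOK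

/-! ### The core: from a distinguisher to the advice -/

/-- **Valid program parameters** at `(aP m, MP m, dP n m)` for any cap `≥ q^d`. [cite: Umans2003, §3, §5] -/
theorem prmOK (n m cap : ℕ) (hcap : qP m ^ dP n m ≤ cap) : PrmOK cap (aP m) (MP m) (dP n m) c0 :=
  ⟨one_le_a m, M_succ m, le_trans (by norm_num) (d_ge n m), coprime_c0_d n m, by rw [qOf]; exact hcap⟩

/-- `zL` with the reduced offset is `zOf`. [folklore] -/
theorem zL_eq_zOf (a M d cstar i : ℕ) :
    zL (rOf a M d) (cstar % ((2 ^ (M + 1)) ^ d - 1)) ((2 ^ (M + 1)) ^ d - 1) i = zOf a M d cstar i := by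
  rw [zL, zOf, Nat.add_mod (cstar % _) 1, Nat.mod_mod, ← Nat.add_mod]

/-- `digitsL` at `q = 2^{M+1}` is `digitsOf`. [folklore] -/
theorem digitsL_eq (M d z : ℕ) : digitsL d (2 ^ (M + 1)) z = digitsOf M d z := rfl

/-- **The advice of the reconstruction machine** built from the predictor data, the good curves and
the offset. [cite: Umans2003, Thm. 14 (the advice)] -/
def advOf (cap n m : ℕ) [Fact (Irreducible (pOf (MP m) (pcOf cap (aP m) (MP m) (dP n m))))] (V : PrmOK cap (aP m) (MP m) (dP n m) c0)
    (xs : List Bool) (C' : Circuit (Fin m)) (j : Fin m) (sgn : Bool) (wc : Fin m → Bool)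
    {r' : ℕ} (b : UmansRec.Idx (dP n m) r' ↪ GF2 (MP m)) (v : UmansRec.Idx (dP n m) r' → LF cap (aP m) (MP m) (dP n m)) (cstar : ℕ) : AdvT :=
  (wprmOf cap (aP m) (MP m) (dP n m) C' j sgn wc (D1 m) (AP m) (I1 n m) (J1 m) (J1 m) (DP n m) (AP m) (IO n m) (JO m) (JO m) b,
    V.stOf ((V.XC xs C' j sgn wc (D1 m) (AP m)).trueState b 0 0 v), V.clOf,
    (n, rOf (aP m) (MP m) (dP n m), cstar % ((2 ^ (MP m + 1)) ^ dP n m - 1), (2 ^ (MP m + 1)) ^ dP n m - 1))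

set_option maxHeartbeats 800000 in
open Classical in
/-- **The core of Thm. 6**: in the regime (`m = m' + 2 ≥ 2²⁰`, `log₂ n ≤ m/4`, `n = |xs| = 2^ℓ`),
a size-`m` distinguisher with advantage `> 1/m` against the parsed-seed binary generator of the table
`xs` yields an advice on which the reconstruction machine reads `xs`. [cite: Umans2003, Thm. 6 (proof), Thm. 14] -/
theorem core_advice {xs : List Bool} {ℓ : ℕ} (hxs : xs.length = 2 ^ ℓ) (m' cap : ℕ) (hs : 2 ^ 20 ≤ m' + 2)
    (hcap : qP (m' + 2) ^ dP xs.length (m' + 2) ≤ cap) (hreg : Nat.log 2 xs.length ≤ (m' + 2) / 4)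
    [hirr : Fact (Irreducible (pOf (MP (m' + 2)) (pcOf cap (aP (m' + 2)) (MP (m' + 2)) (dP xs.length (m' + 2)))))]
    (C : Circuit (Fin (m' + 2))) (hC : C.IsOver B2)
    (hadv : (1 : ℝ) / (m' + 2) < MetaComplexity.prgAdvantage C
      (fun v : Fin ((dP xs.length (m' + 2) + 2) * (MP (m' + 2) + 1)) → Bool =>
        QConv.binGen (labM (MP (m' + 2))) ((prmOK xs.length (m' + 2) cap hcap).GF xs (m' + 2))
          ((prmOK xs.length (m' + 2) cap hcap).seedθ v))) :
    ∃ (C' : Circuit (Fin (m' + 2))) (j : Fin (m' + 2)) (sgn : Bool) (wc : Fin (m' + 2) → Bool)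
      (b : UmansRec.Idx (dP xs.length (m' + 2)) (r'P xs.length (m' + 2)) ↪ GF2 (MP (m' + 2)))
      (v : UmansRec.Idx (dP xs.length (m' + 2)) (r'P xs.length (m' + 2)) → LF cap (aP (m' + 2)) (MP (m' + 2)) (dP xs.length (m' + 2)))
      (cstar : ℕ), C'.IsOver B2 ∧ C'.size ≤ C.size + 1 ∧
      ∀ ib : List Bool, ib.length = ℓ →
        hOut (advOf cap xs.length (m' + 2) (prmOK xs.length (m' + 2) cap hcap) xs C' j sgn wc b v cstar) ib = [xs.getD (bitsToNat ib) false] := by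
  have R : Regime xs.length (m' + 2) := ⟨hs, hreg⟩
  -- (1) the dense predictor
  obtain ⟨j, C', sgn, wc, hj, hC', hsize', hgood⟩ :=
    (prmOK xs.length (m' + 2) cap hcap).exists_dense_predictor xs m' C hC (D₁ := D1 (m' + 2)) (A₁ := AP (m' + 2)) R.hAD hadv
  -- (2) the density and the node embeddings
  have hm1 : 1 ≤ m' + 2 := by omega
  have hq2 : 2 * (m' + 2) ^ 2 ≤ 2 ^ (MP (m' + 2) + 1) := by
    rw [← qP]; refine le_trans ?_ (Prm.m16_le_q (m' + 2))
    calc 2 * (m' + 2) ^ 2 ≤ (m' + 2) * (m' + 2) ^ 2 := Nat.mul_le_mul_right _ (by omega)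
      _ = (m' + 2) ^ 3 := by ring
      _ ≤ (m' + 2) ^ 16 := Nat.pow_le_pow_right hm1 (by norm_num)
  have hμge := (prmOK xs.length (m' + 2) cap hcap).density hm1 hq2 hgood
  have hq2r : (2 * ((m' + 2 : ℕ) : ℝ) ^ 2) ≤ ((2 ^ (MP (m' + 2) + 1) : ℕ) : ℝ) := by exact_mod_cast hq2
  have hm2pos : (0 : ℝ) < 2 * ((m' + 2 : ℕ) : ℝ) ^ 2 := by positivity
  have hμ1 : (1 : ℝ) ≤ ((2 ^ (MP (m' + 2) + 1) : ℕ) : ℝ) *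
      ((UmansRec.Ctx.goodSeeds ((prmOK xs.length (m' + 2) cap hcap).XC xs C' j sgn wc (D1 (m' + 2)) (AP (m' + 2)))).card : ℝ) /
        Fintype.card (LF cap (aP (m' + 2)) (MP (m' + 2)) (dP xs.length (m' + 2))) :=
    le_trans (by rw [le_div_iff₀ hm2pos]; linarith) hμge
  have hAμ : 2 * (AP (m' + 2) : ℝ) ≤ ((2 ^ (MP (m' + 2) + 1) : ℕ) : ℝ) *
      ((UmansRec.Ctx.goodSeeds ((prmOK xs.length (m' + 2) cap hcap).XC xs C' j sgn wc (D1 (m' + 2)) (AP (m' + 2)))).card : ℝ) /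
        Fintype.card (LF cap (aP (m' + 2)) (MP (m' + 2)) (dP xs.length (m' + 2))) := by
    refine le_trans ?_ hμge
    have h := R.A_floor.1
    rw [le_div_iff₀ hm2pos, ← qP]
    have : ((4 * (m' + 2) ^ 2 * AP (m' + 2) : ℕ) : ℝ) ≤ qP (m' + 2) := by exact_mod_cast h
    push_cast at this ⊢; linarith
  have hrq : (dP xs.length (m' + 2) + 1) * r'P xs.length (m' + 2) ≤ 2 ^ (MP (m' + 2) + 1) := by
    rw [← qP]
    have hd := d_le_m R
    calc (dP xs.length (m' + 2) + 1) * r'P xs.length (m' + 2) ≤ (m' + 2 + 1) * (2 * (m' + 2) + 6) := by rw [r'P]; gcongr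
      _ ≤ (2 * (m' + 2)) * (4 * (m' + 2)) := Nat.mul_le_mul (by omega) (by omega)
      _ = 8 * (m' + 2) ^ 2 := by ring
      _ ≤ (m' + 2) * (m' + 2) ^ 2 := Nat.mul_le_mul_right _ (by omega)
      _ = (m' + 2) ^ 3 := by ring
      _ ≤ (m' + 2) ^ 16 := Nat.pow_le_pow_right hm1 (by norm_num)
      _ ≤ qP (m' + 2) := Prm.m16_le_q (m' + 2)
  obtain ⟨hEmb, hEmb0⟩ := PrmOK.emb_bound (M := MP (m' + 2)) (d := dP xs.length (m' + 2)) hrq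
  have hsmall := R.hsmall hμge hEmb hEmb0
  -- (3) Thm. 14
  have hr : Even ((dP xs.length (m' + 2) + 1) * r'P xs.length (m' + 2)) := by
    rw [r'P]; exact ⟨(dP xs.length (m' + 2) + 1) * (dP xs.length (m' + 2) + 3), by ring⟩
  have hr' : 0 < r'P xs.length (m' + 2) := by rw [r'P]; omega
  have hcardL : (Fintype.card (LF cap (aP (m' + 2)) (MP (m' + 2)) (dP xs.length (m' + 2))) : ℝ) =
      ((2 ^ (MP (m' + 2) + 1) : ℕ) : ℝ) ^ dP xs.length (m' + 2) := by
    rw [PrmOK.card_LF (prmOK xs.length (m' + 2) cap hcap).hlen]; push_cast; ring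
  rw [hcardL] at hsmall
  obtain ⟨b, v, cstar, -, -, hrec⟩ := (prmOK xs.length (m' + 2) cap hcap).recon_advice xs C' j sgn wc (D1 (m' + 2)) (AP (m' + 2)) hj hr hr'
    (D := DP xs.length (m' + 2)) (A := AP (m' + 2)) (I := IO xs.length (m' + 2)) (J := JO (m' + 2)) (I₁ := I1 xs.length (m' + 2))
    (J₁ := J1 (m' + 2)) (cap₁ := J1 (m' + 2)) (ℓ₁ := ℓ1 (m' + 2)) R.one_le_D1 R.hℓ R.hIJ1 R.hA1 le_rfl R.hIJO R.hAO
    (le_of_eq (by rw [DP, DφP, hP, aP])) R.hDq rfl hAμ hμ1 (by rw [hcardL]; exact hsmall)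
  refine ⟨C', j, sgn, wc, b, v, cstar, hC', hsize', fun ib hib => ?_⟩
  -- (4) the machine reads `x_i`
  have hi : bitsToNat ib < xs.length := by rw [hxs, ← hib]; exact bitsToNat_lt ib
  have hcorr := (prmOK xs.length (m' + 2) cap hcap).recon_correct xs (Prm.n_le xs.length (m' + 2)) C' hC' j hj sgn wc
    (D₁ := D1 (m' + 2)) (A₁ := AP (m' + 2)) (I₁ := I1 xs.length (m' + 2)) (J₁ := J1 (m' + 2)) (cap₁ := J1 (m' + 2)) (ℓ₁ := ℓ1 (m' + 2))
    (D := DP xs.length (m' + 2)) (A := AP (m' + 2)) (I := IO xs.length (m' + 2)) (J := JO (m' + 2)) (capO := JO (m' + 2))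
    R.hℓ R.one_le_D1 R.hIJ1 R.hA1 le_rfl R.hIJO R.hAO le_rfl b v cstar hrec ⟨bitsToNat ib, hi⟩
  rw [hOut, advOf]
  dsimp only
  rw [if_pos hi, ← hcorr, PrmOK.readoutBit, ← zL_eq_zOf, ← digitsL_eq]
  rfl

/-! ### The length of the advice -/

section Len

/-- Binary numerals below `2ᵏ` have at most `k` bits. [folklore] -/
theorem length_natE_lt {x k : ℕ} (h : x < 2 ^ k) : (natE x).length ≤ k := by rw [length_natE]; exact Nat.size_le.2 h


/-- A table of `q` rows of `d` entries below `2ᵏ`. [folklore] -/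
theorem length_tabE_le {T : Tab} {q d k : ℕ} (hq : T.length ≤ q) (hrow : ∀ r ∈ T, r.length ≤ d ∧ ∀ x ∈ r, x < 2 ^ k) :
    (rawE (rawE natE) T).length ≤ q * (2 * (d * (2 * k + 2)) + 2) :=
  (length_rawE_le_of_forall fun r hr => length_rawE_natE_le_of_lt' (hrow r hr).1 (hrow r hr).2).trans (Nat.mul_le_mul_right _ hq)

variable {cap a M d c0 : ℕ} [hirr : Fact (Irreducible (pOf M (pcOf cap a M d)))] (V : PrmOK cap a M d c0)
include V

/-- The tables of a window have bounded code. [folklore] -/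
theorem length_winOf_le {n₀ : ℕ} (W : Fin n₀ → GF2 M → LF cap a M d) :
    (rawE (rawE (rawE natE)) (V.winOf W)).length ≤ n₀ * (2 * (2 ^ (M + 1) * (2 * (d * (2 * (M + 1) + 2)) + 2)) + 2) := by
  refine (length_rawE_le_of_forall fun T hT => ?_).trans (by unfold PrmOK.winOf; rw [List.length_ofFn])
  unfold PrmOK.winOf at hT
  obtain ⟨k, rfl⟩ := List.mem_ofFn.1 hT
  refine length_tabE_le (by rw [PrmOK.tabOf, List.length_map, List.length_range]) fun r hr => ?_
  rw [PrmOK.tabOf] at hr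
  obtain ⟨bb, -, rfl⟩ := List.mem_map.1 hr
  exact ⟨(PrmOK.reprL_rep V.hlen _).1.le, (PrmOK.reprL_rep V.hlen _).2⟩

end Len

/-- `W = (m+3)²⁰` dominates the unary/binary sizes in play (regime). [folklore] -/
theorem W_bounds {n m : ℕ} (R : Regime n m) :
    let W := (m + 3) ^ 20
    qP m ≤ W ∧ m * qP m ≤ W ∧ (m + 2) * (16 * m + 18) ≤ W ∧ 2048 * m ^ 8 ≤ W ∧ 16 * m ^ 2 + 2 ≤ W ∧ 9 * m ^ 4 ≤ W ∧
      (m + 1) * (2 * ((2 * m + 6) * (2 * (16 * m + 1) + 2)) + 2) ≤ W ∧ m * (2 * (16 * m + 1) + 2) ≤ W ∧ 200 ≤ W := by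
  intro W
  have hm := R.hm
  have hm1 : 1 ≤ m := le_trans (by norm_num) hm
  have hq : qP m ≤ 2 ^ 16 * (m + 2) ^ 16 := by
    rw [q_eq]; have := h_lt m
    calc hP m ^ 16 ≤ (2 * (m + 2)) ^ 16 := Nat.pow_le_pow_left this.le 16
      _ = 2 ^ 16 * (m + 2) ^ 16 := by rw [mul_pow]
  have h3 : 2 ^ 16 ≤ (m + 3) ^ 3 := le_trans (by norm_num : 2 ^ 16 ≤ (2 ^ 6) ^ 3) (Nat.pow_le_pow_left (by omega) 3)
  have h16 : (m + 2) ^ 16 ≤ (m + 3) ^ 16 := Nat.pow_le_pow_left (by omega) 16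
  have hmq : m * qP m ≤ W := by
    calc m * qP m ≤ (m + 3) * (2 ^ 16 * (m + 2) ^ 16) := Nat.mul_le_mul (by omega) hq
      _ ≤ (m + 3) * ((m + 3) ^ 3 * (m + 3) ^ 16) := Nat.mul_le_mul_left _ (Nat.mul_le_mul h3 h16)
      _ = W := by ring
  have hqW : qP m ≤ W := le_trans (Nat.le_mul_of_pos_left _ (by omega)) hmq
  have hp : ∀ k c : ℕ, c ≤ (m + 3) ^ (20 - k) → k ≤ 20 → c * m ^ k ≤ W := fun k c hc hk => by
    calc c * m ^ k ≤ (m + 3) ^ (20 - k) * (m + 3) ^ k := Nat.mul_le_mul hc (Nat.pow_le_pow_left (by omega) k)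
      _ = W := by rw [← pow_add, Nat.sub_add_cancel hk]
  have hc : ∀ e : ℕ, 2048 ≤ (m + 3) ^ (e + 2) := fun e =>
    le_trans (by norm_num : 2048 ≤ (2 ^ 6) ^ 2) ((Nat.pow_le_pow_left (by omega) 2).trans (Nat.pow_le_pow_right (by omega) (by omega)))
  refine ⟨hqW, hmq, ?_, hp 8 2048 (hc 10) (by norm_num), ?_, hp 4 9 ((hc 14).trans' (by norm_num)) (by norm_num), ?_, ?_, (hc 18).trans' (by norm_num)⟩
  · calc (m + 2) * (16 * m + 18) ≤ 34 * m ^ 2 := by nlinarith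
      _ ≤ W := hp 2 34 ((hc 16).trans' (by norm_num)) (by norm_num)
  · calc 16 * m ^ 2 + 2 ≤ 18 * m ^ 2 := by nlinarith
      _ ≤ W := hp 2 18 ((hc 16).trans' (by norm_num)) (by norm_num)
  · calc (m + 1) * (2 * ((2 * m + 6) * (2 * (16 * m + 1) + 2)) + 2) ≤ 600 * m ^ 3 := by nlinarith [pow_pos (by omega : 0 < m) 2]
      _ ≤ W := hp 3 600 ((hc 15).trans' (by norm_num)) (by norm_num)
  · calc m * (2 * (16 * m + 1) + 2) ≤ 36 * m ^ 2 := by nlinarith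
      _ ≤ W := hp 2 36 ((hc 16).trans' (by norm_num)) (by norm_num)

/-- `2m + 4 ≤ 2ᵐ` for `m ≥ 4`. [folklore] -/
theorem two_mul_add_four_le_pow {m : ℕ} (hm : 4 ≤ m) : 2 * m + 4 ≤ 2 ^ m := by
  induction m, hm using Nat.le_induction with
  | base => norm_num
  | succ k hk ih => rw [pow_succ]; omega

/-- `a ≤ m` in the regime (`2ᵃ < 2(m+2) ≤ 2ᵐ`). [folklore] -/
theorem a_le_m {n m : ℕ} (R : Regime n m) : aP m ≤ m := by
  have h := h_lt m
  rw [hP] at h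
  have h4 : 4 ≤ m := le_trans (by norm_num) R.hm
  have h2 := two_mul_add_four_le_pow h4
  by_contra hlt
  push Not at hlt
  have : 2 ^ m < 2 ^ aP m := Nat.pow_lt_pow_right (by norm_num) hlt
  omega

/-- The length of the advice code, top level. [folklore] -/
theorem length_advE_eq (W0 : WPrm) (S0 : WStateL) (cl : List ℕ) (n r c P : ℕ) :
    (advE (W0, S0, cl, (n, r, c, P))).length = 2 * (wprmE W0).length + 2 + (2 * (wstE S0).length + 2 + (2 * (rawE natE cl).length + 2 +
      (2 * (natE n).length + 2 + (2 * (natE r).length + 2 + (2 * (natE c).length + 2 + (natE P).length))))) := by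
  simp only [advE, pairE_apply, length_boolPair]

/-- The length of the state code. [folklore] -/
theorem length_wstE_eq (z : ℕ) (W1 W2 : List Tab) :
    (wstE (z, W1, W2)).length = 2 * (natE z).length + 2 + (2 * (rawE (rawE (rawE natE)) W1).length + 2 + (rawE (rawE (rawE natE)) W2).length) := by
  simp only [wstE, pairE_apply, length_boolPair]

/-- The length of the predictor-data code. [folklore] -/
theorem length_gdE_eq (w1 w2 : List Bool) (sg : Bool) (c : ℕ × ℕ × ℕ) (q I J dm A cp D : ℕ) :
    (gdE ((w1, w2, sg), (c, q, I, J), (dm, A, cp, D))).length =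
      2 * (2 * w1.length + 2 + (2 * w2.length + 2 + 1)) + 2 +
        (2 * (2 * (2 * c.1 + 2 + (2 * (natE c.2.1).length + 2 + (natE c.2.2).length)) + 2 + (2 * q + 2 + (2 * I + 2 + J))) + 2 +
          (2 * dm + 2 + (2 * (natE A).length + 2 + (2 * cp + 2 + D)))) := by
  obtain ⟨c1, c2, c3⟩ := c
  simp only [gdE, pdE, kctxE, pairE_apply, length_boolPair, length_unE, bitE, strE, id, List.length_singleton]

/-- The length of the Sudan-parameter code. [folklore] -/
theorem length_sparsE_eq (c : ℕ × ℕ × ℕ) (q I J D A cp d n₀ : ℕ) :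
    (sparsE (((c, (q, I, J)), ((D, A, cp), d)), n₀)).length =
      2 * (2 * (2 * (2 * c.1 + 2 + (2 * (natE c.2.1).length + 2 + (natE c.2.2).length)) + 2 + (2 * q + 2 + (2 * I + 2 + J))) + 2 +
        (2 * (2 * D + 2 + (2 * (natE A).length + 2 + cp)) + 2 + d)) + 2 + n₀ := by
  obtain ⟨c1, c2, c3⟩ := c
  simp only [sparsE, kctxE, pairE_apply, length_boolPair, length_unE]

/-- The length of the walk-data code. [folklore] -/
theorem length_wprmE_eq (gd : GDat) (sp : SPars) (bn : List (List ℕ)) (pc : List ℕ) (kσ q' P T : ℕ) :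
    (wprmE (gd, sp, bn, ((pc, kσ), (q', P, T)))).length =
      2 * (gdE gd).length + 2 + (2 * (sparsE sp).length + 2 + (2 * (rawE (rawE natE) bn).length + 2 +
        (2 * (2 * (rawE natE pc).length + 2 + kσ) + 2 + (2 * (natE q').length + 2 + (2 * (natE P).length + 2 + T))))) := by
  simp only [wprmE, pairE_apply, length_boolPair, length_unE]

section LenMain

attribute [local irreducible] Prm.MP Prm.aP Prm.dP Prm.qP Prm.AP Prm.DP Prm.I1 Prm.IO

set_option maxHeartbeats 800000 in
/-- **The advice is short**: `|advE adv| ≤ (m+3)⁶⁰` in the regime (with `|C'| ≤ m + 1`).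
[cite: Umans2003, Thm. 14 ("the advice has length `poly(m)`")] -/
theorem length_advE_le {n m cap : ℕ} (R : Regime n m) [Fact (Irreducible (pOf (MP m) (pcOf cap (aP m) (MP m) (dP n m))))]
    (V : PrmOK cap (aP m) (MP m) (dP n m) c0) (xs : List Bool) (C' : Circuit (Fin m)) (hC' : C'.size ≤ m + 1)
    (j : Fin m) (sgn : Bool) (wc : Fin m → Bool)
    (b : UmansRec.Idx (dP n m) (r'P n m) ↪ GF2 (MP m)) (v : UmansRec.Idx (dP n m) (r'P n m) → LF cap (aP m) (MP m) (dP n m)) (cstar : ℕ) :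
    (advE (advOf cap n m V xs C' j sgn wc b v cstar)).length ≤ ((m + 3) ^ 20) ^ 3 := by
  obtain ⟨hqW, hmq, hdesc, hJO, h16, h9, hbnW, hpcW, h200⟩ := W_bounds R
  set W := (m + 3) ^ 20 with hW
  have hm := R.two_le_m
  have hm1 : 1 ≤ m := by omega
  have hd := d_le_m R
  have ha := a_le_m R
  have hM : MP m + 1 = 16 * aP m := by rw [M_succ, c0, mul_comm]
  have hM16 : MP m + 1 ≤ 16 * m := by rw [hM]; omega
  -- atoms
  have hq1 : 1 ≤ qP m := le_trans (Nat.one_le_pow 16 m hm1) (Prm.m16_le_q m)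
  have hmW : m ≤ W := le_trans (by rw [mul_comm]; exact Nat.le_mul_of_pos_left m hq1) hmq
  have hmm : m ≤ m ^ 2 := Nat.le_self_pow (by norm_num) m
  have A1 : (CircEval.desc C').length ≤ W :=
    (CircEval.length_desc_le C').trans ((Nat.mul_le_mul (by omega : C'.size + 1 ≤ m + 2) (by omega : 8 * (m + C'.size) + 10 ≤ 16 * m + 18)).trans hdesc)
  have A2 : (List.ofFn wc).length ≤ W := by rw [List.length_ofFn]; exact hmW
  have A3 : MP m + 2 ≤ W := by omega
  have Af : (natE (canonIrredBits (MP m))).length ≤ MP m + 2 := length_natE_lt (canonIrredBits_spec (MP m)).2.1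
  have Aq : (natE (2 ^ (MP m + 1))).length ≤ MP m + 2 := length_natE_lt (Nat.pow_lt_pow_right (by norm_num) (by omega))
  have hq : 2 ^ (MP m + 1) = qP m := by rw [qP]
  have AA : AP m ≤ qP m := by rw [AP]; exact Nat.div_le_self _ _
  have AAn : (natE (AP m)).length ≤ W := (length_natE_le _).trans (AA.trans hqW)
  have AI1 : I1 n m ≤ W := by rw [I1]; exact (Nat.sub_le _ _).trans (AA.trans hqW)
  have AIO : Prm.IO n m ≤ W := by rw [Prm.IO]; exact (Nat.sub_le _ _).trans (AA.trans hqW)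
  have AJ1 : J1 m ≤ W := by
    rw [J1]; refine le_trans ?_ hJO
    exact Nat.mul_le_mul (by norm_num) (Nat.pow_le_pow_right hm1 (by norm_num))
  have AJO : JO m ≤ W := by rw [JO]; exact hJO
  have AD : DP n m ≤ W := R.D_le.trans h9
  -- lists
  have Abn : (rawE (rawE natE) (PrmOK.bnOf (M := MP m) b)).length ≤ W := by
    refine (length_tabE_le (q := dP n m + 1) (d := r'P n m) (k := MP m + 1) (by rw [PrmOK.bnOf, List.length_ofFn]) fun r hr => ?_).trans ?_
    · rw [PrmOK.bnOf] at hr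
      obtain ⟨e, rfl⟩ := List.mem_ofFn.1 hr
      exact ⟨by rw [List.length_ofFn], fun x hx => by obtain ⟨k, rfl⟩ := List.mem_ofFn.1 hx; exact toBits_lt _ _⟩
    · refine le_trans ?_ hbnW
      rw [r'P]; gcongr; omega
  have Apc : (rawE natE (pcOf cap (aP m) (MP m) (dP n m))).length ≤ W := by
    refine (length_rawE_natE_le_of_lt' (le_of_eq V.pc_spec.1.1) V.pc_spec.1.2).trans (le_trans ?_ hpcW)
    gcongr; omega
  have Acl : (rawE natE V.clOf).length ≤ W := by
    have hcl : (PrmOK.clOf V).length = dP n m := by unfold PrmOK.clOf; rw [List.length_ofFn]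
    refine (length_rawE_natE_le_of_lt' (W := MP m + 1) (le_of_eq hcl) fun x hx => ?_).trans (le_trans ?_ hpcW)
    · unfold PrmOK.clOf at hx; obtain ⟨jj, rfl⟩ := List.mem_ofFn.1 hx; exact toBits_lt _ _
    · gcongr; omega
  have Akσ : (MP m + 1) * (dP n m - 1) ≤ W := by
    calc (MP m + 1) * (dP n m - 1) ≤ 16 * m * m := Nat.mul_le_mul hM16 (by omega)
      _ = 16 * m ^ 2 := by ring
      _ ≤ W := by omega
  -- binary sizes of the big numbers: all below `2^{(M+1) d + 1}`
  have hbig : ∀ x, x < 2 ^ ((MP m + 1) * dP n m + 1) → (natE x).length ≤ W := fun x hx =>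
    (length_natE_lt hx).trans (by calc (MP m + 1) * dP n m + 1 ≤ 16 * m * m + 1 := Nat.succ_le_succ (Nat.mul_le_mul hM16 hd)
                                      _ = 16 * m ^ 2 + 1 := by ring
                                      _ ≤ W := by omega)
  have hqd : (2 ^ (MP m + 1)) ^ dP n m = 2 ^ ((MP m + 1) * dP n m) := by rw [← pow_mul]
  have hPlt : (2 ^ (MP m + 1)) ^ dP n m - 1 < 2 ^ ((MP m + 1) * dP n m + 1) :=
    lt_of_lt_of_le (Nat.sub_lt (Nat.pow_pos (Nat.two_pow_pos _)) Nat.one_pos) (by rw [hqd]; exact Nat.pow_le_pow_right (by norm_num) (by omega))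
  have AP1 : (natE ((2 ^ (MP m + 1)) ^ dP n m - 1)).length ≤ W := hbig _ hPlt
  have Aq' : (natE ((2 ^ (MP m + 1)) ^ (dP n m - 1))).length ≤ W := hbig _ (by
    calc (2 ^ (MP m + 1)) ^ (dP n m - 1) ≤ (2 ^ (MP m + 1)) ^ dP n m := Nat.pow_le_pow_right (Nat.two_pow_pos _) (Nat.sub_le _ _)
      _ = 2 ^ ((MP m + 1) * dP n m) := hqd
      _ < _ := Nat.pow_lt_pow_right (by norm_num) (by omega))
  have Ar : (natE (rOf (aP m) (MP m) (dP n m))).length ≤ W := hbig _ (by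
    have := r_lt (a := aP m) (M := MP m) (d := dP n m); rwa [mul_comm] at this)
  have Ac : (natE (cstar % ((2 ^ (MP m + 1)) ^ dP n m - 1))).length ≤ W :=
    hbig _ (lt_of_le_of_lt (Nat.mod_lt _ (Nat.sub_pos_of_lt (Nat.one_lt_pow (by have := d_ge n m; omega) (Nat.one_lt_two_pow (by omega))))).le hPlt)
  have An : (natE n).length ≤ W := hbig _ (by
    have h1 := Prm.n_le n m
    have h2 : hP m ^ dP n m ≤ (2 ^ (MP m + 1)) ^ dP n m := Nat.pow_le_pow_left (by rw [hq, q_eq]; exact Nat.le_self_pow (by norm_num) _) _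
    rw [hqd] at h2
    have h3 : 1 ≤ hP m ^ dP n m := Nat.one_le_pow _ _ (by have := two_le_h m; omega)
    calc n ≤ hP m ^ dP n m - 1 := h1
      _ < 2 ^ ((MP m + 1) * dP n m + 1) := by have := Nat.pow_le_pow_right (show 0 < 2 by norm_num) (Nat.le_succ ((MP m + 1) * dP n m)); omega)
  have AT : ((j : ℕ) + 1) * 2 ^ (MP m + 1) ≤ W := by rw [hq]; exact le_trans (Nat.mul_le_mul_right _ (by omega : (j : ℕ) + 1 ≤ m)) hmq
  -- the tables
  have Atab : ∀ (Wf : Fin (V.XC xs C' j sgn wc (D1 m) (AP m)).n₀ → GF2 (MP m) → LF cap (aP m) (MP m) (dP n m)),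
      (rawE (rawE (rawE natE)) (V.winOf Wf)).length ≤ W * W := by
    intro Wf
    refine (length_winOf_le V Wf).trans ?_
    rw [PrmOK.XC_n₀]
    have h1 : dP n m * (2 * (MP m + 1) + 2) ≤ m * (2 * (16 * m) + 2) := Nat.mul_le_mul hd (by omega)
    have h2 : qP m * (2 * (dP n m * (2 * (MP m + 1) + 2)) + 2) ≤ qP m * (2 * (m * (2 * (16 * m) + 2)) + 2) := Nat.mul_le_mul_left _ (by omega)
    have h3 : (j : ℕ) * (2 * (qP m * (2 * (dP n m * (2 * (MP m + 1) + 2)) + 2)) + 2) ≤ m * (2 * (qP m * (2 * (m * (2 * (16 * m) + 2)) + 2)) + 2) :=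
      Nat.mul_le_mul j.2.le (by omega)
    rw [hq]
    calc (j : ℕ) * (2 * (qP m * (2 * (dP n m * (2 * (MP m + 1) + 2)) + 2)) + 2)
        ≤ m * (2 * (qP m * (2 * (m * (2 * (16 * m) + 2)) + 2)) + 2) := h3
      _ = 128 * (m ^ 3 * qP m) + 8 * (m ^ 2 * qP m) + 4 * (m * qP m) + 2 * m := by ring
      _ ≤ (150 * m ^ 3) * qP m := by
          have e1 : m ^ 2 * qP m ≤ m ^ 3 * qP m := Nat.mul_le_mul_right _ (Nat.pow_le_pow_right hm1 (by norm_num))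
          have e2 : m * qP m ≤ m ^ 3 * qP m := Nat.mul_le_mul_right _ (Nat.le_self_pow (by norm_num) m)
          have e3 : m ≤ m ^ 3 * qP m := le_trans (Nat.le_self_pow (by norm_num) m) (Nat.le_mul_of_pos_right _ (by omega))
          have e4 : (150 * m ^ 3) * qP m = 150 * (m ^ 3 * qP m) := by ring
          rw [e4]; omega
      _ ≤ W * W := Nat.mul_le_mul (by
          calc 150 * m ^ 3 ≤ (m + 3) ^ 17 * (m + 3) ^ 3 := Nat.mul_le_mul (le_trans (by norm_num : 150 ≤ 2 ^ 17) (Nat.pow_le_pow_left (by omega) 17)) (Nat.pow_le_pow_left (by omega) 3)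
            _ = W := by rw [hW, ← pow_add]) hqW
  -- expand and combine
  have hz : (natE ((V.XC xs C' j sgn wc (D1 m) (AP m)).trueState b 0 0 v).1).length = 0 := rfl
  have AW1 := Atab ((V.XC xs C' j sgn wc (D1 m) (AP m)).trueState b 0 0 v).2.1
  have AW2 := Atab ((V.XC xs C' j sgn wc (D1 m) (AP m)).trueState b 0 0 v).2.2
  have hb1 : (bitE sgn).length = 1 := rfl
  have hW2 : 200 * W ≤ W * W := Nat.mul_le_mul_right _ h200
  have hW3 : 200 * (W * W) ≤ W * W * W := by rw [mul_assoc]; exact Nat.mul_le_mul_right _ h200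
  have hj : (j : ℕ) ≤ W := le_trans j.2.le hmW
  have hdW : dP n m ≤ W := le_trans hd hmW
  have hd1 : dP n m - 1 ≤ W := le_trans (Nat.sub_le _ _) hdW
  have hk1 : (kctx (MP m)).1 = MP m + 2 := rfl
  have hk2 : (natE (kctx (MP m)).2.1).length ≤ MP m + 2 := Af
  have hk3 : (natE (kctx (MP m)).2.2).length ≤ MP m + 2 := Aq
  have hD1 : D1 m ≤ W := by rw [D1, ← AP]; exact AA.trans hqW
  rw [show ((m + 3) ^ 20) ^ 3 = W * W * W by rw [hW]; ring]
  rw [advOf, length_advE_eq, PrmOK.stOf, length_wstE_eq, wprmOf, length_wprmE_eq, length_gdE_eq, length_sparsE_eq]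
  simp only [hq] at *
  omega

end LenMain

/-! ## The final assembly -/

/-! ### Generic facts -/

/-- The universal bound is at most `5 · 2ˡ`. [folklore] -/
theorem univBound_le (ℓ : ℕ) : univBound ℓ + 4 ≤ 5 * 2 ^ ℓ := by
  induction ℓ with
  | zero => simp [univBound]
  | succ k ih => rw [univBound, pow_succ]; omega

/-- **Every string has a circuit of size `< 2^{ℓ+3}`** (`ℓ = ⌈log₂(|Y|+1)⌉`): the trivial upper bound
on `CC(Y)`. [cite: MurrayWilliams2018, §2 ("every function has circuits of size `O(2ⁿ/n)`", weak form)] -/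
theorem stringCC_lt (Y : List Bool) : stringCC Y < 2 ^ (Nat.clog 2 (Y.length + 1) + 3) := by
  classical
  set ℓ := Nat.clog 2 (Y.length + 1)
  have h := cktSize_univ (ι := Fin ℓ) (fun x (_ : Unit) => MetaComplexity.ofTruthTable (padTable Y) (length_padTable Y) x)
  obtain ⟨C, hB, hsize, hev⟩ := CktSize.toCircuit h
  have hcomp : C.Computes (MetaComplexity.ofTruthTable (padTable Y) (length_padTable Y)) := fun x => hev x
  have h1 : stringCC Y ≤ univBound ℓ := by
    rw [stringCC]; exact (circuitSizeOver_le_of_computes C hB hcomp).trans (by rw [Fintype.card_fin] at hsize; exact hsize)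
  have h2 := univBound_le ℓ
  calc stringCC Y < 5 * 2 ^ ℓ := by omega
    _ < 8 * 2 ^ ℓ := by have := Nat.two_pow_pos ℓ; omega
    _ = 2 ^ (ℓ + 3) := by rw [pow_add]; norm_num; ring

/-- `Nat.log (2ᵃ) (2ˡ) = l / a` (`a ≥ 1`). [folklore] -/
theorem log_pow_pow {a l : ℕ} (ha : 1 ≤ a) : Nat.log (2 ^ a) (2 ^ l) = l / a := by
  refine Nat.log_eq_of_pow_le_of_lt_pow ?_ ?_
  · rw [← pow_mul]; exact Nat.pow_le_pow_right (by norm_num) (Nat.mul_div_le l a)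
  · rw [← pow_mul]; exact Nat.pow_lt_pow_right (by norm_num) (Nat.lt_mul_div_succ l ha)

/-- `|Y| + 2 ≥ 2^{ℓ-1}` (`ℓ = ⌈log₂(|Y|+1)⌉`). [folklore] -/
theorem two_pow_clog_le (Y : List Bool) : 2 ^ (Nat.clog 2 (Y.length + 1) - 1) ≤ Y.length + 2 := by
  rcases Nat.lt_or_ge (Y.length + 1) 2 with h1 | h2
  · have : Nat.clog 2 (Y.length + 1) = 0 := by
      rw [Nat.clog_of_right_le_one]; omega
    rw [this]; norm_num
  · have := Nat.pow_pred_clog_lt_self (b := 2) (by norm_num) h2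
    rw [Nat.pred_eq_sub_one] at this; omega

/-- `clog₂(x+1) ≤ log₂ x + 1`. [folklore] -/
theorem clog_le_log_succ (x : ℕ) : Nat.clog 2 (x + 1) ≤ Nat.log 2 x + 1 := by
  rw [Nat.clog_le_iff_le_pow (by norm_num)]
  rcases Nat.eq_zero_or_pos x with rfl | hx
  · norm_num
  · exact Nat.lt_pow_succ_log_self (by norm_num) x

/-- Parsing reads only the first `k b` bits. [folklore] -/
theorem parseL_take (b k : ℕ) (w : List Bool) : parseL b k (w.take (k * b)) = parseL b k w := by
  rw [parseL, parseL]
  refine List.map_congr_left fun i hi => ?_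
  have hi := List.mem_range.1 hi
  congr 1
  rw [List.drop_take, List.take_take]
  congr 1
  have : b ≤ k * b - i * b := by
    rw [← Nat.sub_mul]; exact Nat.le_mul_of_pos_left b (by omega)
  omega

/-- The first `n` bits of `ofFn s` are `ofFn (restrictSeed s)`. [folklore] -/
theorem take_ofFn_eq_restrict {ℓ n : ℕ} (h : n ≤ ℓ) (s : Fin ℓ → Bool) : (List.ofFn s).take n = List.ofFn (restrictSeed h s) := by
  apply List.ext_getElem (by rw [List.length_take, List.length_ofFn, List.length_ofFn]; omega) fun i h1 h2 => ?_
  rw [List.getElem_take, List.getElem_ofFn, List.getElem_ofFn]; rfl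

/-- **Ignored seed bits do not change the advantage.** [folklore] -/
theorem prgAdvantage_restrict {ℓ n m : ℕ} (h : n ≤ ℓ) (C : Circuit (Fin m)) (G : (Fin n → Bool) → (Fin m → Bool)) :
    MetaComplexity.prgAdvantage C (fun s : Fin ℓ → Bool => G (restrictSeed h s)) = MetaComplexity.prgAdvantage C G := by
  classical
  rw [MetaComplexity.prgAdvantage, MetaComplexity.prgAdvantage]
  congr 2
  rw [card_filter_restrict h (fun v => C.eval (G v) = true)]
  push_cast
  have : (2 : ℝ) ^ ℓ = 2 ^ (ℓ - n) * 2 ^ n := by rw [← pow_add, Nat.sub_add_cancel h]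
  rw [this, mul_div_mul_left _ _ (by positivity)]

/-! ### The generator and its constant -/

/-- **The string function of Umans' generator** exists in `FP` (`genTop 16`). [cite: Umans2003, Thm. 6] -/
theorem genF_exists : ∃ F : List Bool → List Bool, F ∈ FP ∧ ∀ (Y : List Bool) (s : ℕ) (w : List Bool),
    F (boolPair (boolPair Y (ones s)) w) = genTop 16 Y s w := by
  obtain ⟨f, hf, hspec⟩ := genTopC 16
  refine ⟨f, hf, fun Y s w => ?_⟩
  have := hspec ((Y, s), w)
  simpa only [pairE_apply, unE_eq_ones, strE, id] using this

/-- **Umans' string function** `F ⟨⟨Y, 1ˢ⟩, seed⟩ = genTop 16 Y s seed`. [cite: Umans2003, Thm. 6] -/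
def genF : List Bool → List Bool := Classical.choose genF_exists

/-- `genF ∈ FP`. [cite: Umans2003, Thm. 6] -/
theorem genF_mem_FP : genF ∈ FP := (Classical.choose_spec genF_exists).1

/-- `genF` computes `genTop 16`. [cite: Umans2003, Thm. 6] -/
theorem genF_apply (Y : List Bool) (s : ℕ) (w : List Bool) : genF (boolPair (boolPair Y (ones s)) w) = genTop 16 Y s w :=
  (Classical.choose_spec genF_exists).2 Y s w

/-- **The seed constant** `g = 61 · deg Q_H + Q_H(1) + 2⁶¹`. [cite: Umans2003, Thm. 6 ("a universal constant")] -/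
def gU : ℕ := 61 * QH.natDegree + QH.eval 1 + 2 ^ 61

/-- `2⁶¹ ≤ g`. [folklore] -/
theorem gU_ge : 2 ^ 61 ≤ gU := Nat.le_add_left _ _

/-! ### The regime arithmetic -/

section RegimeArith

attribute [local irreducible] Prm.MP Prm.aP Prm.dP Prm.qP

set_option exponentiation.threshold 2048 in
/-- **The parameters of a hard instance are in the regime and under the cap**: with
`k = g(⌊log₂|Y|⌋+1) < s`, `sᵍ ≤ CC(Y)`: `s ≥ 2⁶¹`, `log₂ n ≤ s/4`, `q^d ≤ (|Y|+s+k+2)^{1000}` and the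
parsed seed fits, `(d+2)(M+1) ≤ k`. [cite: Umans2003, Thm. 6 (proof, parameter bookkeeping)] -/
theorem regime_of_hard (Y : List Bool) (s : ℕ) (hks : gU * (Nat.log 2 Y.length + 1) < s) (hhard : s ^ gU ≤ stringCC Y) :
    2 ^ 61 ≤ s ∧ Regime (padTable Y).length s ∧
      qP s ^ dP (padTable Y).length s ≤ (Y.length + s + gU * (Nat.log 2 Y.length + 1) + 2) ^ capExp ∧
      (dP (padTable Y).length s + 2) * (MP s + 1) ≤ gU * (Nat.log 2 Y.length + 1) := by
  have hg := gU_ge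
  have hk1 : gU ≤ gU * (Nat.log 2 Y.length + 1) := Nat.le_mul_of_pos_right _ (Nat.succ_pos _)
  have hs : 2 ^ 61 ≤ s := by omega
  have hs1 : 2 ≤ s := le_trans (by norm_num) hs
  -- `ℓ` and `n = 2^ℓ`
  have hn : (padTable Y).length = 2 ^ Nat.clog 2 (Y.length + 1) := length_padTable Y
  have hℓ : Nat.clog 2 (Y.length + 1) ≤ Nat.log 2 Y.length + 1 := clog_le_log_succ Y.length
  have hlogn : Nat.log 2 (padTable Y).length = Nat.clog 2 (Y.length + 1) := by rw [hn, Nat.log_pow (by norm_num)]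
  -- `g log₂ s < ℓ + 3`
  have hlt := lt_of_le_of_lt hhard (stringCC_lt Y)
  have hlogs : gU * Nat.log 2 s < Nat.clog 2 (Y.length + 1) + 3 := by
    have h1 : 2 ^ (gU * Nat.log 2 s) ≤ s ^ gU := by
      rw [mul_comm, pow_mul]; exact Nat.pow_le_pow_left (Nat.pow_log_le_self 2 (by omega)) _
    exact (Nat.pow_lt_pow_iff_right (by norm_num)).1 (lt_of_le_of_lt h1 hlt)
  -- `a ≤ log₂ s + 2`
  have ha : aP s ≤ Nat.log 2 s + 2 := by
    have h1 := h_lt s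
    rw [hP] at h1
    have h2 : s < 2 ^ (Nat.log 2 s + 1) := Nat.lt_pow_succ_log_self (by norm_num) s
    have h3 : 2 ^ aP s < 2 ^ (Nat.log 2 s + 3) := by
      calc 2 ^ aP s < 2 * (s + 2) := h1
        _ ≤ 4 * s := by omega
        _ < 4 * 2 ^ (Nat.log 2 s + 1) := by omega
        _ = 2 ^ (Nat.log 2 s + 3) := by rw [pow_add, pow_add]; norm_num; ring
    have := (Nat.pow_lt_pow_iff_right (by norm_num)).1 h3
    omega
  have ha1 := one_le_a s
  -- `d ≤ 2 ℓ/a + 38`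
  have hd := (d_spec (padTable Y).length s).2.2.2
  rw [hn, c0, hP, log_pow_pow ha1] at hd
  -- products
  have had : aP s * dP (2 ^ Nat.clog 2 (Y.length + 1)) s ≤ 2 * Nat.clog 2 (Y.length + 1) + 38 * aP s := by
    have h1 : aP s * (Nat.clog 2 (Y.length + 1) / aP s) ≤ Nat.clog 2 (Y.length + 1) := Nat.mul_div_le _ _
    have h2 : dP (2 ^ Nat.clog 2 (Y.length + 1)) s ≤ 2 * (17 + (Nat.clog 2 (Y.length + 1) / aP s + 1)) + 2 :=
      hd.trans (by gcongr; exact max_le (le_add_right le_rfl) (le_add_left le_rfl))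
    calc aP s * dP (2 ^ Nat.clog 2 (Y.length + 1)) s ≤ aP s * (2 * (17 + (Nat.clog 2 (Y.length + 1) / aP s + 1)) + 2) := Nat.mul_le_mul_left _ h2
      _ = 2 * (aP s * (Nat.clog 2 (Y.length + 1) / aP s)) + 38 * aP s := by ring
      _ ≤ _ := by omega
  -- `g · (a - 2) ≤ g log s < ℓ + 3`, so `g a ≤ ℓ + 2 + 2g`; everything in terms of `L := ℓ`, `g`
  have hga : gU * aP s ≤ Nat.clog 2 (Y.length + 1) + 2 + 2 * gU := by
    have : gU * aP s ≤ gU * (Nat.log 2 s + 2) := Nat.mul_le_mul_left _ ha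
    rw [mul_add] at this; omega
  rw [← hn] at had
  refine ⟨hs, ⟨le_trans (by norm_num) hs, ?_⟩, ?_, ?_⟩
  · -- `log₂ n = ℓ ≤ s / 4`: `g ℓ ≤ k < s`
    rw [hlogn, Nat.le_div_iff_mul_le (by norm_num)]
    have : Nat.clog 2 (Y.length + 1) * gU ≤ gU * (Nat.log 2 Y.length + 1) := by rw [mul_comm]; exact Nat.mul_le_mul_left _ hℓ
    have h4 : 4 ≤ gU := le_trans (by norm_num) hg
    calc Nat.clog 2 (Y.length + 1) * 4 ≤ Nat.clog 2 (Y.length + 1) * gU := Nat.mul_le_mul_left _ h4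
      _ ≤ s := by omega
  · -- the cap: `q^d = 2^{16 a d}` and `16 a d ≤ 33 ℓ + 1218 ≤ 500(ℓ - 1) + 30500`
    have e1 : qP s ^ dP (padTable Y).length s = 2 ^ (16 * (aP s * dP (padTable Y).length s)) := by
      rw [q_eq, hP, ← pow_mul, ← pow_mul]; ring_nf
    rw [e1]
    -- `16 a d · g ≤ 32 ℓ g + 608 (ℓ + 2 + 2g)`; with `g ≥ 2^61 ≥ 608`: `16 a d ≤ 32ℓ + ℓ + 2 + 1216`
    have h16 : 16 * (aP s * dP (padTable Y).length s) ≤ 33 * Nat.clog 2 (Y.length + 1) + 1218 := by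
      have h1 : gU * (16 * (aP s * dP (padTable Y).length s)) ≤ gU * (32 * Nat.clog 2 (Y.length + 1)) + 608 * (gU * aP s) := by
        calc gU * (16 * (aP s * dP (padTable Y).length s)) ≤ gU * (16 * (2 * Nat.clog 2 (Y.length + 1) + 38 * aP s)) :=
              Nat.mul_le_mul_left _ (Nat.mul_le_mul_left _ had)
          _ = gU * (32 * Nat.clog 2 (Y.length + 1)) + 608 * (gU * aP s) := by ring
      have h2 : 608 * (gU * aP s) ≤ 608 * (Nat.clog 2 (Y.length + 1) + 2 + 2 * gU) := Nat.mul_le_mul_left _ hga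
      have h3 : 608 * Nat.clog 2 (Y.length + 1) + 1216 ≤ gU * (Nat.clog 2 (Y.length + 1) + 2) := by
        calc 608 * Nat.clog 2 (Y.length + 1) + 1216 = 608 * (Nat.clog 2 (Y.length + 1) + 2) := by ring
          _ ≤ gU * (Nat.clog 2 (Y.length + 1) + 2) := Nat.mul_le_mul_right _ (le_trans (by norm_num) hg)
      have h4 : gU * (16 * (aP s * dP (padTable Y).length s)) ≤ gU * (33 * Nat.clog 2 (Y.length + 1) + 1218) := by
        have e : gU * (33 * Nat.clog 2 (Y.length + 1) + 1218) = gU * (32 * Nat.clog 2 (Y.length + 1)) + gU * (Nat.clog 2 (Y.length + 1) + 2) + 1216 * gU := by ring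
        rw [e]
        have e2 : 608 * (Nat.clog 2 (Y.length + 1) + 2 + 2 * gU) = (608 * Nat.clog 2 (Y.length + 1) + 1216) + 1216 * gU := by ring
        rw [e2] at h2
        omega
      exact Nat.le_of_mul_le_mul_left h4 (by omega)
    -- the base is at least `2^{max(ℓ-1, 61)}`
    have hY := two_pow_clog_le Y
    have ht : 2 ^ max (Nat.clog 2 (Y.length + 1) - 1) 61 ≤ Y.length + s + gU * (Nat.log 2 Y.length + 1) + 2 := by
      rcases le_total (Nat.clog 2 (Y.length + 1) - 1) 61 with h | h
      · rw [max_eq_right h]; omega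
      · rw [max_eq_left h]; omega
    rw [capExp]
    calc 2 ^ (16 * (aP s * dP (padTable Y).length s)) ≤ 2 ^ (max (Nat.clog 2 (Y.length + 1) - 1) 61 * 1000) :=
          Nat.pow_le_pow_right (by norm_num) (by
            have := le_max_left (Nat.clog 2 (Y.length + 1) - 1) 61
            have := le_max_right (Nat.clog 2 (Y.length + 1) - 1) 61
            omega)
      _ = (2 ^ max (Nat.clog 2 (Y.length + 1) - 1) 61) ^ 1000 := by rw [pow_mul]
      _ ≤ (Y.length + s + gU * (Nat.log 2 Y.length + 1) + 2) ^ 1000 := Nat.pow_le_pow_left ht 1000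
  · -- the seed: `(d+2)(M+1) = 16 a (d+2) ≤ 32ℓ + 640 a ≤ 48 ℓ + 1312 ≤ g ℓ'`
    rw [M_succ, c0]
    have h1 : (dP (padTable Y).length s + 2) * (aP s * 16) = 16 * (aP s * dP (padTable Y).length s) + 32 * aP s := by ring
    rw [h1]
    have h2 : gU * (16 * (aP s * dP (padTable Y).length s) + 32 * aP s) ≤ gU * (gU * (Nat.log 2 Y.length + 1)) := by
      have e : gU * (16 * (aP s * dP (padTable Y).length s) + 32 * aP s) ≤ gU * (32 * Nat.clog 2 (Y.length + 1)) + 640 * (gU * aP s) := by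
        calc gU * (16 * (aP s * dP (padTable Y).length s) + 32 * aP s) ≤ gU * (16 * (2 * Nat.clog 2 (Y.length + 1) + 38 * aP s) + 32 * aP s) := by
              gcongr
          _ = gU * (32 * Nat.clog 2 (Y.length + 1)) + 640 * (gU * aP s) := by ring
      have e2 : 640 * (gU * aP s) ≤ 640 * (Nat.clog 2 (Y.length + 1) + 2 + 2 * gU) := Nat.mul_le_mul_left _ hga
      -- `32 g ℓ + 640 ℓ + 1280 + 1280 g ≤ g · g · (log|Y| + 1)` since `g (log|Y|+1) ≥ g max(ℓ,1)`… use `ℓ ≤ log|Y| + 1`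
      have e3 : gU * (32 * Nat.clog 2 (Y.length + 1)) + 640 * (Nat.clog 2 (Y.length + 1) + 2 + 2 * gU) ≤ gU * (gU * (Nat.log 2 Y.length + 1)) := by
        have hL : Nat.clog 2 (Y.length + 1) ≤ Nat.log 2 Y.length + 1 := hℓ
        set L' := Nat.log 2 Y.length + 1 with hL'
        have hL1 : 1 ≤ L' := by omega
        calc gU * (32 * Nat.clog 2 (Y.length + 1)) + 640 * (Nat.clog 2 (Y.length + 1) + 2 + 2 * gU)
            ≤ gU * (32 * L') + 640 * (L' + 2 + 2 * gU) := by gcongr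
          _ = (32 * gU + 640) * L' + 1280 + 1280 * gU := by ring
          _ ≤ (32 * gU + 640) * L' + (1280 + 1280 * gU) * L' := by nlinarith
          _ = (1312 * gU + 1920) * L' := by ring
          _ ≤ (gU * gU) * L' := Nat.mul_le_mul_right _ (by nlinarith)
          _ = gU * (gU * L') := by ring
      exact e.trans ((Nat.add_le_add_left e2 _).trans e3)
    exact Nat.le_of_mul_le_mul_left h2 (by omega)

end RegimeArith

/-! ### The final count -/

/-- **A polynomial loses to `sᵍ`**: `Q((s+3)⁶⁰ + ℓ) < s^{61 deg Q + Q(1) + 2⁶¹}` for `s ≥ 2⁶¹`, `ℓ ≤ s`. [folklore] -/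
theorem poly_lt_pow (Q : Polynomial ℕ) (s ℓ : ℕ) (hs : 2 ^ 61 ≤ s) (hℓ : ℓ ≤ s) :
    Q.eval (((s + 3) ^ 20) ^ 3 + ℓ) < s ^ (61 * Q.natDegree + Q.eval 1 + 2 ^ 61) := by
  have hs1 : 1 ≤ s := le_trans (by norm_num) hs
  have h1 : ((s + 3) ^ 20) ^ 3 + ℓ ≤ s ^ 61 := by
    have h2 : s + 3 ≤ 2 * s := by omega
    have h3 : ((s + 3) ^ 20) ^ 3 ≤ 2 ^ 60 * s ^ 60 := by
      rw [← pow_mul, ← mul_pow]; exact Nat.pow_le_pow_left h2 _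
    have h4 : 2 ^ 60 * s ^ 60 + s ≤ s ^ 61 := by
      have h5 : 2 ^ 60 * s ^ 60 + s ^ 60 ≤ s * s ^ 60 := by
        rw [← Nat.succ_mul]; exact Nat.mul_le_mul_right _ (by omega)
      have h6 : s ≤ s ^ 60 := Nat.le_self_pow (by norm_num) s
      have e : s ^ 61 = s * s ^ 60 := by ring
      rw [e]; omega
    omega
  refine lt_of_le_of_lt (natPoly_eval_mono Q h1) ?_
  refine lt_of_le_of_lt (natPoly_eval_le_eval_one_mul_pow Q (Nat.one_le_pow _ _ hs1)) ?_
  rw [← pow_mul]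
  have h5 : Q.eval 1 < s ^ (Q.eval 1 + 2 ^ 61) := by
    calc Q.eval 1 < 2 ^ (Q.eval 1) := Nat.lt_two_pow_self
      _ ≤ s ^ Q.eval 1 := Nat.pow_le_pow_left (by omega) _
      _ ≤ s ^ (Q.eval 1 + 2 ^ 61) := Nat.pow_le_pow_right hs1 (Nat.le_add_right _ _)
  calc Q.eval 1 * s ^ (61 * Q.natDegree) < s ^ (Q.eval 1 + 2 ^ 61) * s ^ (61 * Q.natDegree) :=
        Nat.mul_lt_mul_of_pos_right h5 (Nat.pow_pos (by omega))
    _ = s ^ (61 * Q.natDegree + Q.eval 1 + 2 ^ 61) := by rw [← pow_add]; ring_nf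

/-- **`Q_H` loses to `sᵍ`.** [folklore] -/
theorem QH_lt_pow (s ℓ : ℕ) (hs : 2 ^ 61 ≤ s) (hℓ : ℓ ≤ s) : QH.eval (((s + 3) ^ 20) ^ 3 + ℓ) < s ^ gU :=
  poly_lt_pow QH s ℓ hs hℓ

/-! ### Umans' generator -/

set_option maxHeartbeats 800000 in
/-- **Pseudorandomness of Umans' generator** (the heart of Thm. 6 in Murray–Williams' interface).
[cite: Umans2003, Thm. 6; MurrayWilliams2018, Thm. 2.3] -/
theorem genF_fools (Y : List Bool) (s : ℕ) (hs1 : 1 ≤ s) (hhard : s ^ gU ≤ stringCC Y) :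
    IsSizePseudorandom (fun (seed : Fin (gU * (Nat.log 2 Y.length + 1)) → Bool) (i : Fin s) =>
      (genF (boolPair (boolPair Y (ones s)) (List.ofFn seed))).getD i false) := by
  classical
  unfold IsSizePseudorandom Fools
  intro C hC hCsize
  by_cases hsk : s ≤ gU * (Nat.log 2 Y.length + 1)
  · -- the output is the seed prefix: uniform
    have hG : (fun (seed : Fin (gU * (Nat.log 2 Y.length + 1)) → Bool) (i : Fin s) =>
        (genF (boolPair (boolPair Y (ones s)) (List.ofFn seed))).getD i false) = fun seed => id (restrictSeed hsk seed) := by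
      funext seed i
      rw [genF_apply, genTop, genL, if_pos (by rw [List.length_ofFn]; exact hsk), List.getD_eq_getElem _ _ (by
        rw [List.length_take, List.length_ofFn]; exact lt_min i.2 (lt_of_lt_of_le i.2 hsk)), List.getElem_take, List.getElem_ofFn]
      rfl
    rw [hG, prgAdvantage_restrict hsk C id, MetaComplexity.prgAdvantage]
    simp only [id, sub_self, abs_zero]
    positivity
  · push Not at hsk
    -- the main case: by contradiction with the hardness of `Y`
    by_contra hadv
    push Not at hadv
    obtain ⟨hs, R, hcap, hnb⟩ := regime_of_hard Y s hsk hhard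
    obtain ⟨m', rfl⟩ : ∃ m', s = m' + 2 := ⟨s - 2, by omega⟩
    have V := prmOK (padTable Y).length (m' + 2) _ hcap
    haveI := V.fact_irreducible
    -- the full generator factors through the parsed-seed generator
    set Gcore : (Fin ((dP (padTable Y).length (m' + 2) + 2) * (MP (m' + 2) + 1)) → Bool) → Fin (m' + 2) → Bool :=
      fun v => QConv.binGen (labM (MP (m' + 2))) ((prmOK (padTable Y).length (m' + 2) _ hcap).GF (padTable Y) (m' + 2))
        ((prmOK (padTable Y).length (m' + 2) _ hcap).seedθ v) with hGc
    have hG : (fun (seed : Fin (gU * (Nat.log 2 Y.length + 1)) → Bool) (i : Fin (m' + 2)) =>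
        (genF (boolPair (boolPair Y (ones (m' + 2))) (List.ofFn seed))).getD i false) = fun seed => Gcore (restrictSeed hnb seed) := by
      funext seed i
      rw [genF_apply, genTop, List.length_ofFn, genL, List.length_ofFn, if_neg (by omega)]
      have hgc := (prmOK (padTable Y).length (m' + 2) _ hcap).genCoreL_getD (padTable Y) (Prm.n_le (padTable Y).length (m' + 2)) (m' + 2)
        (List.ofFn seed) i
      change (genCoreL ((Y.length + (m' + 2) + gU * (Nat.log 2 Y.length + 1) + 2) ^ capExp) (padTable Y) (m' + 2) (List.ofFn seed)
        (aP (m' + 2)) (MP (m' + 2)) (dP (padTable Y).length (m' + 2))).getD i false = _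
      rw [hgc.2 (parseL_getD_lt _ _ _ _), hGc]
      simp only [PrmOK.seedθ_apply]
      unfold seedParse
      simp only [← take_ofFn_eq_restrict hnb seed, parseL_take]
    rw [hG, prgAdvantage_restrict hnb C Gcore] at hadv
    have hadv' : (1 : ℝ) / (m' + 2) < MetaComplexity.prgAdvantage C Gcore := by
      have e : ((m' + 2 : ℕ) : ℝ) = (m' : ℝ) + 2 := by push_cast; ring
      rw [← e]; exact hadv
    -- the core and the count
    obtain ⟨C', j, sgn, wc, b, v, cstar, hC', hsize', hread⟩ :=
      core_advice (length_padTable Y) m' _ (le_trans (by norm_num) hs) hcap R.hn C hC hadv'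
    have hcc := stringCC_le_of_advice Y _ hread
    have hlen := length_advE_le R (prmOK (padTable Y).length (m' + 2) _ hcap) (padTable Y) C' (hsize'.trans (by omega)) j sgn wc b v cstar
    have hℓ : Nat.clog 2 (Y.length + 1) ≤ m' + 2 := by
      have := clog_le_log_succ Y.length
      have : Nat.log 2 Y.length + 1 ≤ gU * (Nat.log 2 Y.length + 1) := Nat.le_mul_of_pos_left _ (by have := gU_ge; omega)
      omega
    have hlt := QH_lt_pow (m' + 2) (Nat.clog 2 (Y.length + 1)) hs hℓ
    have := natPoly_eval_mono QH (Nat.add_le_add_right hlen (Nat.clog 2 (Y.length + 1)))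
    omega

/-- **Umans' generator** (Umans 2003, Thm. 6) in Murray–Williams' interface (Thm. 2.3): the string
function `genTop 16 ∈ FP`, seed constant `g = 61 deg Q_H + Q_H(1) + 2⁶¹`, fooling size `s` with error
`≤ 1/s` on seeds of `g(⌊log₂|Y|⌋+1)` bits whenever `sᵍ ≤ CC(Y)`. [cite: Umans2003, Thm. 6; MurrayWilliams2018, Thm. 2.3] -/
def umansGenerator : UmansGenerator where
  F := genF
  g := gU
  F_mem_FP := genF_mem_FP
  one_le_g := le_trans (by norm_num) gU_ge
  fools := genF_fools

end UmansFP

/-- **Lemma 4.1 (a.e. form) from Umans' generator** (the tree's closer applied to `umansGenerator`);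
the named fact's discharge `MurrayWilliams2018_lemma_4_1_ae_holds` is in
`MurrayWilliams2018EasyWitnessProofs.lean`. [cite: MurrayWilliams2018, Lemma 4.1; Umans2003, Thm. 6] -/
theorem MurrayWilliams2018_lemma_4_1_ae_of_umans : MurrayWilliams2018_lemma_4_1_ae :=
  MurrayWilliams2018_lemma_4_1_ae_of_umansGenerator UmansFP.umansGenerator

end Literature.Computability.Complexity

end
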